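import Summits.QuantumFields.YangMills.Theorems.UnitScaleTiltProp7HcoSEndToEnd
import Summits.QuantumFields.YangMills.Theorems.UnitScaleTiltProp7CmapTwInputs
import HarnessLib

/-!
# Route `UnitScaleTilt`, crux K1 «MinimiserStabilityRegPr» (stmt-QuantumFields-19200) — ARCHITECTURE (A′) ON Σ: **THE SUP ROW OF THE COMB CHART REMAINDER IS A THEOREM**
# ([Balaban1985Variational] (44)∕(47) «C_j(U, A) … begins with second order terms», through ✓`Prop7CmapTwInputs.inputs_CmapTw`), AND THE E2E KNIT WITH IT DISCHARGED:
# `hcoS` ⇐ {(N06) `norm_G₀ᶜ`, (P-A2) the `ℓ¹` comb-remainder binder with its crude divergence slice} — v2 of ✓`Prop7HcoSEndToEnd.hcoS_of_normG0_of_combRemainderRows`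

Cell `ym3-torus` ∕ fleet seat `ym-ust-19200-p1` (gen 18, route-R E′ growth-side lead ∕ namer).  THEOREMS ONLY (0 `def`, 0 `sorry`); `--supports stmt-QuantumFields-19200`, count-neutral.
YM₃ on T³ is a ladder rung (R3), not the Clay problem; nothing here claims the stub, the crux, `hcoS`, d = 4 or the mass gap — (N06) and the `ℓ¹` binder stay DISPLAYED.

WHY.  v1 of the knit displayed, next to the `ℓ¹` binder, a SUP row `‖C(W, iX)(ĉ)‖ ≤ kσ·e` (it makes the QSMALL penalty fourth order).  That row is print's (44)∕(47) read pointwise: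
★w1∕★w2-20520's ✓`inputs_CmapTw` gives `‖C(W, A)‖_∞ ≤ C₂‖A‖_∞²` on `‖A‖_∞ < R∕2`, `R = e_c·η`, `C₂ = 40M₀∕R²`, `M₀ = 2(500e_c + 600L(3e_c + 18ε₀))`, at every `W ∈ RegPr F n K ε₀` inside the
(WΣ) windows at `(ε₀, e_c)`; with `e_c := 2ε₂` and `‖iX‖_∞ < ε₂η` ((19)) this is `‖C(W, iX)(ĉ)‖ ≤ 10·M₀ = 20(1000ε₂ + 600L(6ε₂ + 18ε₀))` — L-only × the radii, no `η`, no volume.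

WHAT IS PROVED (ns `…Theorems.Prop7CmapTwSupRow`): ★★ `norm_CmapTw_apply_le_of_in19` (the SUP row at a printed-regular background from (19), windows VERBATIM those of ✓`inputs_CmapTw` at
`(ε₀, e) := (ε₀, 2ε₂)`); ★★★ `hcoS_of_normG0_of_combRemainderL1Rows` — v1 with the SUP conjunct of `hPA2` REMOVED (displayed: (N06) `hN06` VERBATIM; (P-A2) per `(L, B₁′)` L-only `(eJ, C₁, C₂, ζ, δ₁)`
with, on the `hcoS` binder, `∃ dv, Σ_ĉ‖C(W,iX)ĉ‖ ≤ C₁ℓ⁻¹M + C₂ℓ(K + dv) ∧ dv ≤ ζK + δ₁ℓ⁻²M`); CONCLUSION `hcoS` VERBATIM.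
HONEST SCOPE.  Composition over landed theorems + real arithmetic; (N06) and the `ℓ¹` binder are displayed; nothing of print asserted; rung R3, not Clay; YM gap NOT proved.

References: T. Bałaban, CMP 102 (1985) 277–309 [Balaban1985Variational] ((19) p.281, (44)–(47) pp.285–286, (106)–(111) p.294, (141)–(142) p.299); CMP 99 (1985) 389–434
[Balaban1985BackgroundPropagators] ((3.14) p.393, Thm 3.11 p.416); CMP 98 (1985) 17–51 [Balaban1985Averaging] (Prop. 4 (134)–(135) p.38).
-/

set_option autoImplicit false
noncomputable section

open scoped BigOperators Matrix.Norms.L2Operator Matrix Topology InnerProductSpace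
open Filter NormedSpace Metric

namespace Summit.QuantumFields.YangMills.Theorems.Prop7CmapTwSupRow

open Literature.MathematicalPhysics.QuantumFieldTheory.Balaban1983to89
open Literature.MathematicalPhysics.QuantumFieldTheory.Balaban1983to89.T3ContinuumYM3Torus
open Literature.MathematicalPhysics.QuantumFieldTheory.Balaban1983to89.T3UnitLawDensityEML (ℰp)
open Literature.MathematicalPhysics.QuantumFieldTheory.Balaban1983to89.T3ConstrainedMinimiser (fibre)
open Literature.MathematicalPhysics.QuantumFieldTheory.Balaban1983to89.T3PrintedRegularMinimiser
open Literature.MathematicalPhysics.QuantumFieldTheory.Balaban1983to89.T3RegularMinimiser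
open Literature.MathematicalPhysics.QuantumFieldTheory.Balaban1983to89.T3Thm1Carrier
open T4Continuum BlockAveraging AveragingRT ExpMeanLog BlockAveragingEMLLinearised BlockAveragingEMLLinearisedBackground BlockAveragingEMLProp2
open B10Eq27TorusAxialLog (pull)
open T3SectALandauChart (emb15 eta eta_pos bgUnits In19)
open B11Eq103H1Complex (BondL2K laplaceAK)
open B7Prop2Explicit (C0 c2')
open B7Prop3Flat (c3)
open Summit.QuantumFields.YangMills.Theorems.Prop7SPrint (basePt RestrictedPrint AvgCondPrint IsLandauPrint)
open Summit.QuantumFields.YangMills.Theorems.Prop7TPrint (expHermField)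
open Summit.QuantumFields.YangMills.Theorems.Prop7SectET3Transport (periodsT3)
open Summit.QuantumFields.YangMills.Theorems.Prop7SectET3HilbertLetters (W₂ toL2 toL2B DL2 DstarL2)
open Summit.QuantumFields.YangMills.Theorems.Prop7SectET3WilsonHessian (DeltaEta DeltaEtaSlot)
open Summit.QuantumFields.YangMills.Theorems.Prop7SectET3CombLetters (Qkc)
open Summit.QuantumFields.YangMills.Theorems.Prop7QprimeCombL2 (RcombL2)
open Summit.QuantumFields.YangMills.Theorems.Prop7SymAvgTw (QTw CmapTw)
open Summit.QuantumFields.YangMills.Theorems.Prop7CmapTwInputs (inputs_CmapTw)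
open Summit.QuantumFields.YangMills.Theorems.Prop7ChartWindows (windowsS_of_small)
open Summit.QuantumFields.YangMills.Theorems.Prop7HcoSEndToEnd (hcoS_of_normG0_of_combRemainderRows summand_window)

variable (F : T3Family) {n K : ℕ} (h : n ≤ K)

/-! ## §1 The SUP row of the comb chart remainder from (19) -/

/-- ★★ **THE SUP ROW `‖C(W, iX)(ĉ)‖ ≤ 20·(1000ε₂ + 600L(6ε₂ + 18ε₀))` AT A PRINTED-REGULAR BACKGROUND FROM (19).**  Hypotheses: `RegPr F n K ε₀ W`, the windows of ✓`inputs_CmapTw`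
VERBATIM at `(ε₀, e) := (ε₀, 2ε₂)`, and (19) `In19 F n K ε₂ W U₁ X` (only its bond member `‖X b‖ < ε₂η` is used).  Proof: `Inputs.quad` at `A := iX` (`‖iX‖_∞ < ε₂η = R∕2`, `R = 2ε₂η`) gives
`‖C(W, iX)‖_∞ ≤ (40M₀∕R²)·‖iX‖_∞² ≤ 10M₀`; then `‖C ĉ‖ ≤ ‖C‖_∞`. [cite: Balaban1985Variational, (44) p.285, (47) p.286, (19) p.281; Balaban1985BackgroundPropagators, (3.14) p.393; Balaban1985Averaging, Prop. 4 (134)-(135) p.38] -/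
theorem norm_CmapTw_apply_le_of_in19 {ε₀ ε₂ : ℝ} (hε₀ : 0 < ε₀) (hε₂ : 0 < ε₂)
    (hε : 10 ^ 7 * (F.L : ℝ) ^ 3 * ε₀ ≤ 1) (he6 : 10 ^ 6 * (F.L : ℝ) ^ 2 * (2 * ε₂) ≤ 1)
    (hα3 : C0 (F.P K).d * (2 * ε₀) ≤ 1 / 3) (hα4 : 4 * (2 * ε₀) ≤ c2' (F.P K).d (F.P K).L)
    (hsmall : Real.exp (4 * (800 * (((F.P K).d : ℝ) + 1) ^ 2 * (((F.P K).d : ℝ) + 4)) * (2 * ε₀))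
      * (1 + 8 * (131072 * (((F.P K).d : ℝ) + 1) ^ 2) * (2 * ε₂)) ≤ 2)
    (hc₃ : 2 * (2 * ε₂) ≤ c3 (F.P K).d (F.P K).L) (hsm : 2048 * ((F.P K).d : ℝ) * (2 * ε₂) ≤ 1)
    (W : GaugeField (F.P K) 0 (Matrix.specialUnitaryGroup (Fin 2) ℂ)) (hreg : RegPr F n K ε₀ W)
    {U₁ : GaugeField (F.P K) 0 (Matrix.specialUnitaryGroup (Fin 2) ℂ)} {X : PBond (F.P K) 0 → Matrix (Fin 2) (Fin 2) ℂ}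
    (h19 : In19 F n K ε₂ W U₁ X) (ĉ : PBond (F.P n) 0) :
    ‖CmapTw F n K h W (fun b => Complex.I • X b) ĉ‖ ≤ 20 * (1000 * ε₂ + 600 * (F.L : ℝ) * (6 * ε₂ + 18 * ε₀)) := by
  have hη : 0 < eta F n K := eta_pos F n K
  have h2ε₂ : 0 < 2 * ε₂ := by positivity
  -- print's Prop 3 inputs for the comb chart at radius `R := 2ε₂·η`, with the trivial `H := 0`
  have hH : ∀ Y : PBond (F.P n) 0 → Matrix (Fin 2) (Fin 2) ℂ,
      ‖(0 : (PBond (F.P n) 0 → Matrix (Fin 2) (Fin 2) ℂ) →ₗ[ℂ] (PBond (F.P K) 0 → Matrix (Fin 2) (Fin 2) ℂ)) Y‖ ≤ 0 * ‖Y‖ := fun Y => by simp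
  have hIn := inputs_CmapTw F h hε₀ h2ε₂ hε he6 hα3 hα4 hsmall hc₃ hsm W hreg hH
  -- `‖iX‖_∞ < ε₂η = 2·(R∕4)`
  have hA : ‖(fun b => Complex.I • X b)‖ < ε₂ * eta F n K := by
    rw [pi_norm_lt_iff (by positivity)]
    intro b
    rw [norm_smul, Complex.norm_I, one_mul]
    exact h19.2.2.1 b
  have hA' : ‖(fun b => Complex.I • X b)‖ < 2 * ((2 * ε₂) * eta F n K / 4) := by linarith
  have hq := hIn.quad (fun b => Complex.I • X b) hA'
  -- `(40M₀∕R²)·‖iX‖² ≤ 10M₀`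
  have hM₀ : 0 ≤ 2 * (500 * (2 * ε₂) + 600 * (F.L : ℝ) * (3 * (2 * ε₂) + 18 * ε₀)) := by positivity
  have hR : 0 < (2 * ε₂) * eta F n K := by positivity
  have hsq : ‖(fun b => Complex.I • X b)‖ ^ 2 ≤ (ε₂ * eta F n K) ^ 2 := by
    have h0 : 0 ≤ ‖(fun b => Complex.I • X b)‖ := norm_nonneg _
    nlinarith
  have hbound : 40 * (2 * (500 * (2 * ε₂) + 600 * (F.L : ℝ) * (3 * (2 * ε₂) + 18 * ε₀))) / ((2 * ε₂) * eta F n K) ^ 2 * ‖(fun b => Complex.I • X b)‖ ^ 2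
      ≤ 20 * (1000 * ε₂ + 600 * (F.L : ℝ) * (6 * ε₂ + 18 * ε₀)) := by
    have hC : 0 ≤ 40 * (2 * (500 * (2 * ε₂) + 600 * (F.L : ℝ) * (3 * (2 * ε₂) + 18 * ε₀))) / ((2 * ε₂) * eta F n K) ^ 2 := by positivity
    calc 40 * (2 * (500 * (2 * ε₂) + 600 * (F.L : ℝ) * (3 * (2 * ε₂) + 18 * ε₀))) / ((2 * ε₂) * eta F n K) ^ 2 * ‖(fun b => Complex.I • X b)‖ ^ 2
        ≤ 40 * (2 * (500 * (2 * ε₂) + 600 * (F.L : ℝ) * (3 * (2 * ε₂) + 18 * ε₀))) / ((2 * ε₂) * eta F n K) ^ 2 * (ε₂ * eta F n K) ^ 2 :=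
          mul_le_mul_of_nonneg_left hsq hC
      _ = 20 * (1000 * ε₂ + 600 * (F.L : ℝ) * (6 * ε₂ + 18 * ε₀)) := by
          field_simp
          ring
  exact (norm_le_pi_norm _ ĉ).trans (hq.trans hbound)

/-! ## §2 The E2E knit v2: the SUP row discharged -/

section E2E

variable (c₀ cB a₀ : ℕ → ℝ) [hc₀ : ∀ L : ℕ, Fact (0 < c₀ L)] [hcB : ∀ L : ℕ, Fact (0 < cB L)]

/-- ★★★ **THE GROWTH SOCKET `hcoS` FROM (N06) `norm_G₀ᶜ` AND THE `ℓ¹` COMB-REMAINDER BINDER WITH ITS CRUDE DIVERGENCE SLICE — THE SUP ROW DISCHARGED** (v2 of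
✓`hcoS_of_normG0_of_combRemainderRows`; the SUP conjunct is §1 at `ε₂ := (2B₁′ + 1)e`, radius shrunk by L-only windows).  CONCLUSION: `hcoS` VERBATIM.
[cite: Balaban1985Variational, (141)-(142) p.299, (19)-(21) p.281, (44)-(47) pp.285-286, (106)-(111) p.294; Balaban1985BackgroundPropagators, Thm 3.11 p.416, Thm 3.3 p.399, (3.14) p.393; Balaban1985Averaging, Prop. 4 (134)-(135) p.38] -/
theorem hcoS_of_normG0_of_combRemainderL1Rows (ha₀ : ∀ L : ℕ, 0 ≤ a₀ L)
    (hN06 : ∀ (L : ℕ), 1 < L → ∃ B₀ eN : ℝ, 0 < B₀ ∧ 0 < eN ∧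
      ∀ (F : T3Family), F.L = L → ∀ (n K : ℕ) (hnK : n < K) (e : ℝ) (W : GaugeField (F.P K) 0 (Matrix.specialUnitaryGroup (Fin 2) ℂ)),
        0 < e → e ≤ eN → RegPr F n K e W →
        ∃ G₀ : BondL2K ℂ 3 (periodsT3 F K) (c₀ F.L) W₂ →ₗ[ℂ] BondL2K ℂ 3 (periodsT3 F K) (c₀ F.L) W₂,
          laplaceAK (DeltaEtaSlot F n K (c₀ F.L) W) (DL2 F n K (c₀ F.L) W) (RcombL2 F n K (c₀ F.L) W) (DstarL2 F n K (c₀ F.L) W)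
              (Qkc F n K hnK.le (c₀ F.L) (cB F.L) W) (LinearMap.adjoint (Qkc F n K hnK.le (c₀ F.L) (cB F.L) W))
              (((a₀ F.L * (c₀ F.L / cB F.L) * ((F.L : ℝ) ^ (K - n)) ^ 3 : ℝ) : ℂ)) ∘ₗ G₀ = LinearMap.id ∧
          ∀ f, ‖G₀ f‖ ≤ B₀ * ‖f‖)
    (hPA2 : ∀ (L : ℕ), 1 < L → ∀ (B₁' : ℝ), 0 < B₁' → ∃ eJ C₁ C₂ ζ δ₁ : ℝ, 0 < eJ ∧ 0 ≤ C₁ ∧ 0 ≤ C₂ ∧ 0 ≤ ζ ∧ 0 ≤ δ₁ ∧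
      ∀ (F : T3Family), F.L = L → ∀ (n K : ℕ) (hnK : n < K) (e : ℝ) (V : GaugeField (F.P n) 0 (Matrix.specialUnitaryGroup (Fin 2) ℂ))
        (W : GaugeField (F.P K) 0 (Matrix.specialUnitaryGroup (Fin 2) ℂ)) (X : PBond (F.P K) 0 → Matrix (Fin 2) (Fin 2) ℂ),
        0 < e → e ≤ eJ → W ∈ regFibrePr F n K hnK.le e V →
        (∀ γ : ℝ → GaugeField (F.P K) 0 (Matrix.specialUnitaryGroup (Fin 2) ℂ), γ 0 = W → (∀ t, γ t ∈ fibre F ℰp n K hnK.le V) →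
          (∀ b, DifferentiableAt ℝ (fun t => ((γ t b : Matrix.specialUnitaryGroup (Fin 2) ℂ) : Matrix (Fin 2) (Fin 2) ℂ)) 0) →
            deriv (fun t => wilsonAction4 (γ t)) 0 = 0) →
        In19 F n K (2 * B₁' * e) W (expHermField X) X → AvgCondPrint F n K hnK.le V W X → IsLandauPrint F n K W X →
          ∃ dv : ℝ, ∑ ĉ : PBond (F.P n) 0, ‖CmapTw F n K hnK.le W (fun b => Complex.I • X b) ĉ‖
              ≤ C₁ * ((F.L : ℝ) ^ (K - n))⁻¹ * (∑ b : PBond (F.P K) 0, ‖X b‖ ^ 2) + C₂ * ((F.L : ℝ) ^ (K - n)) * ((∑ p : Plaq (F.P K) 0, ‖((Complex.I • X ⟨p.src, p.μ⟩) + ((W ⟨p.src, p.μ⟩ : Matrix (Fin 2) (Fin 2) ℂ) * (Complex.I • X ⟨p.src.shift p.μ, p.ν⟩) * star (W ⟨p.src, p.μ⟩ : Matrix (Fin 2) (Fin 2) ℂ))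
            - (((W ⟨p.src, p.μ⟩ * W ⟨p.src.shift p.μ, p.ν⟩ * (W ⟨p.src.shift p.ν, p.μ⟩)⁻¹ : Matrix.specialUnitaryGroup (Fin 2) ℂ) : Matrix (Fin 2) (Fin 2) ℂ) * (Complex.I • X ⟨p.src.shift p.ν, p.μ⟩) * star ((W ⟨p.src, p.μ⟩ * W ⟨p.src.shift p.μ, p.ν⟩ * (W ⟨p.src.shift p.ν, p.μ⟩)⁻¹ : Matrix.specialUnitaryGroup (Fin 2) ℂ) : Matrix (Fin 2) (Fin 2) ℂ))
            - (((GaugeField.plaqHol W p : Matrix.specialUnitaryGroup (Fin 2) ℂ) : Matrix (Fin 2) (Fin 2) ℂ) * (Complex.I • X ⟨p.src, p.ν⟩) * star ((GaugeField.plaqHol W p : Matrix.specialUnitaryGroup (Fin 2) ℂ) : Matrix (Fin 2) (Fin 2) ℂ)))‖ ^ 2) + dv) ∧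
            dv ≤ ζ * (∑ p : Plaq (F.P K) 0, ‖((Complex.I • X ⟨p.src, p.μ⟩) + ((W ⟨p.src, p.μ⟩ : Matrix (Fin 2) (Fin 2) ℂ) * (Complex.I • X ⟨p.src.shift p.μ, p.ν⟩) * star (W ⟨p.src, p.μ⟩ : Matrix (Fin 2) (Fin 2) ℂ))
            - (((W ⟨p.src, p.μ⟩ * W ⟨p.src.shift p.μ, p.ν⟩ * (W ⟨p.src.shift p.ν, p.μ⟩)⁻¹ : Matrix.specialUnitaryGroup (Fin 2) ℂ) : Matrix (Fin 2) (Fin 2) ℂ) * (Complex.I • X ⟨p.src.shift p.ν, p.μ⟩) * star ((W ⟨p.src, p.μ⟩ * W ⟨p.src.shift p.μ, p.ν⟩ * (W ⟨p.src.shift p.ν, p.μ⟩)⁻¹ : Matrix.specialUnitaryGroup (Fin 2) ℂ) : Matrix (Fin 2) (Fin 2) ℂ))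
            - (((GaugeField.plaqHol W p : Matrix.specialUnitaryGroup (Fin 2) ℂ) : Matrix (Fin 2) (Fin 2) ℂ) * (Complex.I • X ⟨p.src, p.ν⟩) * star ((GaugeField.plaqHol W p : Matrix.specialUnitaryGroup (Fin 2) ℂ) : Matrix (Fin 2) (Fin 2) ℂ)))‖ ^ 2) + δ₁ * (((F.L : ℝ) ^ (K - n)) ^ 2)⁻¹ * (∑ b : PBond (F.P K) 0, ‖X b‖ ^ 2)) :
    ∀ (L : ℕ), 1 < L → ∀ (B₁' : ℝ), 0 < B₁' → ∃ e₇ : ℝ, 0 < e₇ ∧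
      ∀ (F : T3Family), F.L = L → ∀ (n K : ℕ) (hnK : n < K) (e : ℝ) (V : GaugeField (F.P n) 0 (Matrix.specialUnitaryGroup (Fin 2) ℂ))
        (W : GaugeField (F.P K) 0 (Matrix.specialUnitaryGroup (Fin 2) ℂ)) (X : PBond (F.P K) 0 → Matrix (Fin 2) (Fin 2) ℂ),
        0 < e → e ≤ e₇ → W ∈ regFibrePr F n K hnK.le e V →
        (∀ γ : ℝ → GaugeField (F.P K) 0 (Matrix.specialUnitaryGroup (Fin 2) ℂ), γ 0 = W → (∀ t, γ t ∈ fibre F ℰp n K hnK.le V) →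
          (∀ b, DifferentiableAt ℝ (fun t => ((γ t b : Matrix.specialUnitaryGroup (Fin 2) ℂ) : Matrix (Fin 2) (Fin 2) ℂ)) 0) →
            deriv (fun t => wilsonAction4 (γ t)) 0 = 0) →
        In19 F n K (2 * B₁' * e) W (expHermField X) X → AvgCondPrint F n K hnK.le V W X → IsLandauPrint F n K W X →
          wilsonAction4 W ≤ wilsonAction4 (emb15 W (expHermField X)) := by
  refine hcoS_of_normG0_of_combRemainderRows c₀ cB a₀ ha₀ hN06 ?_
  intro L hL B₁' hB₁'
  obtain ⟨eJ, C₁, C₂, ζ, δ₁, heJ, hC₁, hC₂, hζ, hδ₁, HJ⟩ := hPA2 L hL B₁' hB₁'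
  have hL0 : (0 : ℝ) < (L : ℝ) := by exact_mod_cast (show 0 < L by omega)
  -- the L-only window constant of §1 at `(ε₀, ε₂) := (e, (2B₁′+1)e)`
  obtain ⟨T, hT_def⟩ : ∃ T : ℝ, T = 10 ^ 7 * (L : ℝ) ^ 3 + 10 ^ 9 * (L : ℝ) ^ 2 + 2 * 10 ^ 9 * (2 * B₁' + 1) * (L : ℝ) ^ 2 := ⟨_, rfl⟩
  have t1 : (0 : ℝ) ≤ 10 ^ 7 * (L : ℝ) ^ 3 := by positivity
  have t2 : (0 : ℝ) ≤ 10 ^ 9 * (L : ℝ) ^ 2 := by positivity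
  have t3 : (0 : ℝ) ≤ 2 * 10 ^ 9 * (2 * B₁' + 1) * (L : ℝ) ^ 2 := by positivity
  have hTpos : 0 < T := by rw [hT_def]; positivity
  refine ⟨min eJ T⁻¹, 20 * (1000 * (2 * B₁' + 1) + 600 * (L : ℝ) * (6 * (2 * B₁' + 1) + 18)), C₁, C₂, ζ, δ₁,
    lt_min heJ (inv_pos.mpr hTpos), by positivity, hC₁, hC₂, hζ, hδ₁, ?_⟩
  intro F hF n K hnK e V W X he heε hWreg hEL h19 h20 h21
  have heJ' : e ≤ eJ := heε.trans (min_le_left _ _)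
  have hTe : T * e ≤ 1 := by
    have h1 := heε.trans (min_le_right _ _)
    calc T * e ≤ T * T⁻¹ := mul_le_mul_of_nonneg_left h1 hTpos.le
      _ = 1 := mul_inv_cancel₀ hTpos.ne'
  have w1 : 10 ^ 7 * (L : ℝ) ^ 3 * e ≤ 1 := summand_window (by rw [hT_def]; linarith) he.le hTe
  have w2 : 10 ^ 9 * (L : ℝ) ^ 2 * e ≤ 1 := summand_window (by rw [hT_def]; linarith) he.le hTe
  have w3 : 2 * 10 ^ 9 * (2 * B₁' + 1) * (L : ℝ) ^ 2 * e ≤ 1 := summand_window (by rw [hT_def]; linarith) he.le hTe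
  subst hF
  refine ⟨?_, HJ F rfl n K hnK e V W X he heJ' hWreg hEL h19 h20 h21⟩
  -- the SUP row by §1
  have hPL : (((F.P K).L : ℕ) : ℝ) = (F.L : ℝ) := rfl
  have hε₂pos : 0 < (2 * B₁' + 1) * e := by positivity
  have h2ε₂pos : 0 < 2 * ((2 * B₁' + 1) * e) := by positivity
  have h2B : 2 * B₁' * e ≤ (2 * B₁' + 1) * e := by rw [add_mul, one_mul]; exact le_add_of_nonneg_right he.le
  have h19' : In19 F n K ((2 * B₁' + 1) * e) W (expHermField X) X := Prop7HcoSEndToEnd.in19_mono h2B h19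
  have hαw : e * (((F.P K).L : ℕ) : ℝ) ^ 2 ≤ 1 / 10 ^ 9 := by
    rw [hPL, le_div_iff₀ (by positivity)]
    calc e * (F.L : ℝ) ^ 2 * 10 ^ 9 = 10 ^ 9 * (F.L : ℝ) ^ 2 * e := by ring
      _ ≤ 1 := w2
  have hεw : 2 * ((2 * B₁' + 1) * e) * (((F.P K).L : ℕ) : ℝ) ^ 2 ≤ 1 / 10 ^ 9 := by
    rw [hPL, le_div_iff₀ (by positivity)]
    calc 2 * ((2 * B₁' + 1) * e) * (F.L : ℝ) ^ 2 * 10 ^ 9 = 2 * 10 ^ 9 * (2 * B₁' + 1) * (F.L : ℝ) ^ 2 * e := by ring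
      _ ≤ 1 := w3
  obtain ⟨hα3, hα4', -, hε20, hsmall, hc₃, hsm, -, -⟩ := windowsS_of_small F K he h2ε₂pos hαw hεw
  have he6 : 10 ^ 6 * (F.L : ℝ) ^ 2 * (2 * ((2 * B₁' + 1) * e)) ≤ 1 := by
    have h0 : 0 ≤ (2 * B₁' + 1) * (F.L : ℝ) ^ 2 * e := by positivity
    calc 10 ^ 6 * (F.L : ℝ) ^ 2 * (2 * ((2 * B₁' + 1) * e)) = 2 * 10 ^ 6 * ((2 * B₁' + 1) * (F.L : ℝ) ^ 2 * e) := by ring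
      _ ≤ 2 * 10 ^ 9 * ((2 * B₁' + 1) * (F.L : ℝ) ^ 2 * e) := mul_le_mul_of_nonneg_right (by norm_num) h0
      _ = 2 * 10 ^ 9 * (2 * B₁' + 1) * (F.L : ℝ) ^ 2 * e := by ring
      _ ≤ 1 := w3
  obtain ⟨hWfib, hreg⟩ := (mem_regFibrePr_iff F).mp hWreg
  intro ĉ
  have hs := norm_CmapTw_apply_le_of_in19 F hnK.le he hε₂pos w1 he6 hα3 hα4' hsmall hc₃ hsm W hreg h19' ĉ
  have heq : 20 * (1000 * ((2 * B₁' + 1) * e) + 600 * (F.L : ℝ) * (6 * ((2 * B₁' + 1) * e) + 18 * e))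
      = 20 * (1000 * (2 * B₁' + 1) + 600 * (F.L : ℝ) * (6 * (2 * B₁' + 1) + 18)) * e := by ring
  rw [heq] at hs
  exact hs

end E2E

end Summit.QuantumFields.YangMills.Theorems.Prop7CmapTwSupRow

end
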